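import Literature.Probability.LatticeModels.HalfPlaneClusterSides
import Literature.Probability.Percolation.HalfAnnulusDuality
import HarnessLib

/-!
# The interface sites of the upper half-plane: the `-`cluster starts right after the `+∗`cluster

Topic `Probability/LatticeModels`; theorems only. In the coexistence situation of
Georgii–Higuchi 2000, §5 (an infinite `+∗`cluster `I^{+∗}_up` and an infinite `-`cluster `I^-_up`
of the upper half-plane, the former touching the axis on the left of the latter), GH describe the
mutual position of the two clusters through the semi-infinite contour `γ_up` (Lemma 5.3: "`γ_up`
starts between two points of the horizontal axis", with `+`face in `I^{+∗}_up` and `-`face in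
`I^-_up`) and, in the proof of Lemma 5.4, through the statistic
`a_n = max{k : (k, n) ∈ I^{+∗}_{π_{n,up}}}`. This file proves the contour-free fact about this
statistic that we use in place of the contour: **the site `(a + 1, 0)` immediately to the right of
the last axis site `(a, 0)` of the infinite `+∗`cluster lies in an infinite `-`cluster of the upper
half-plane** (`infinite_minusCluster_succ_of_isMaxAxis`). Proof: `(a+1, 0)` is a `-`site (a `+`site
there would belong to the `+∗`cluster); if its `-`cluster `F` were finite, symmetrise it to
`C = F ∪ R(F)` and apply the Deuschel–Pisztora/Timár boundary-connectivity theorem of the tree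
(`exists_starWalk_latticeBoundary`) from a far site `x₀` of the `+∗`cluster: the outer-visible
boundary of `C` contains a site of the `+∗`cluster and an axis site `(j, 0)` with `j ≥ a + 2`,
joined by a `∗`-walk inside the boundary; folded into the upper half-plane (`starFoldHom`) this is a
`∗`-walk of `+`sites (boundary sites in the upper half-plane are lattice neighbours of `F`), so
`(j, 0)` lies in the `+∗`cluster — contradicting the maximality of `a`.

With the trap lemma of `HalfPlaneClusterSides` this yields the **touching criterion** for two
configurations `ω, ω̂` (the two layers of the duplicated system, Lemma 5.5, Case 3):
`touch_of_le_maxAxis` — if the last axis site of `I^{+∗}_up(ω̂)` is not to the left of the last axis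
site of `I^{+∗}_up(ω)`, then `I^{+∗}_up(ω̂)` and `I^-_up(ω)` have two sites which coincide or are
lattice neighbours.

## References

* H.-O. Georgii, Y. Higuchi, J. Math. Phys. 41 (2000) 1153–1169, Lemma 5.3, proof of Lemma 5.4
  (the statistic `a_n`) and proof of Lemma 5.5, Case 3 [GeorgiiHiguchi2000].
* Á. Timár, Proc. AMS 141 (2013) 475–480, Theorem 2 [Timar2013].
-/

noncomputable section

open MeasureTheory Filter SimpleGraph
open Literature.Probability.Percolation
open scoped ENNReal

namespace Literature.Probability.LatticeModels

/-! ### Refining a `∗`-walk of the upper half-plane into a lattice walk -/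

section Refine

/-- **Refining a `∗`-walk into a lattice walk, with heights**: every `∗`-walk can be replaced by a
lattice walk with the same ends each of whose vertices is a vertex of the `∗`-walk or
lattice-adjacent to one, and has the height of some vertex of the `∗`-walk (insert the corner
`(u'₀, u₁)` into each diagonal step `u → u'`). [folklore] -/
theorem exists_latticeWalk_of_starWalk_height :
    ∀ {u w : Site 2} (β : zdStarGraph.Walk u w), ∃ β' : (zdGraph 2).Walk u w,
      ∀ v ∈ β'.support, (∃ z ∈ β.support, v = z ∨ (zdGraph 2).Adj v z) ∧ ∃ z ∈ β.support, v 1 = z 1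
  | u, _, Walk.nil => ⟨Walk.nil, fun v hv => ⟨⟨v, hv, Or.inl rfl⟩, v, hv, rfl⟩⟩
  | u, w, Walk.cons (v := u') hadj β => by
    obtain ⟨β', hβ'⟩ := exists_latticeWalk_of_starWalk_height β
    have lift : ∀ v ∈ β'.support, (∃ z ∈ (Walk.cons hadj β).support, v = z ∨ (zdGraph 2).Adj v z) ∧
        ∃ z ∈ (Walk.cons hadj β).support, v 1 = z 1 := by
      intro v hv
      obtain ⟨⟨z, hz, h⟩, z₂, hz₂, h₂⟩ := hβ' v hv
      exact ⟨⟨z, by rw [Walk.support_cons]; exact List.mem_cons_of_mem _ hz, h⟩,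
        z₂, by rw [Walk.support_cons]; exact List.mem_cons_of_mem _ hz₂, h₂⟩
    by_cases hl : (zdGraph 2).Adj u u'
    · refine ⟨Walk.cons hl β', fun v hv => ?_⟩
      rw [Walk.support_cons, List.mem_cons] at hv
      rcases hv with rfl | hv
      · exact ⟨⟨v, by simp, Or.inl rfl⟩, v, by simp, rfl⟩
      · exact lift v hv
    · rw [zdStarGraph_adj] at hadj
      obtain ⟨hne, hclose⟩ := hadj
      have h0 := hclose 0; have h1 := hclose 1
      rw [abs_le] at h0 h1
      rw [zdGraph_adj_iff] at hl
      have hd0 : u' 0 ≠ u 0 := by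
        intro h
        have h1' : u' 1 ≠ u 1 := fun h' => hne (by ext i; fin_cases i <;> simp [h, h'])
        rcases lt_or_gt_of_ne h1' with hlt | hgt
        · exact hl ⟨1, Or.inr (by rw [Site.eq_iff_two]; exact ⟨by simp; omega, by simp; omega⟩)⟩
        · exact hl ⟨1, Or.inl (by rw [Site.eq_iff_two]; exact ⟨by simp; omega, by simp; omega⟩)⟩
      have hd1 : u' 1 ≠ u 1 := by
        intro h
        rcases lt_or_gt_of_ne hd0 with hlt | hgt
        · exact hl ⟨0, Or.inr (by rw [Site.eq_iff_two]; exact ⟨by simp; omega, by simp; omega⟩)⟩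
        · exact hl ⟨0, Or.inl (by rw [Site.eq_iff_two]; exact ⟨by simp; omega, by simp; omega⟩)⟩
      set c : Site 2 := ![u' 0, u 1] with hc
      have huc : (zdGraph 2).Adj u c := by
        rw [zdGraph_adj_iff]
        rcases lt_or_gt_of_ne hd0 with hlt | hgt
        · exact ⟨0, Or.inr (by rw [Site.eq_iff_two]; exact ⟨by simp [hc]; omega, by simp [hc]⟩)⟩
        · exact ⟨0, Or.inl (by rw [Site.eq_iff_two]; exact ⟨by simp [hc]; omega, by simp [hc]⟩)⟩
      have hcu' : (zdGraph 2).Adj c u' := by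
        rw [zdGraph_adj_iff]
        rcases lt_or_gt_of_ne hd1 with hlt | hgt
        · exact ⟨1, Or.inr (by rw [Site.eq_iff_two]; exact ⟨by simp [hc], by simp [hc]; omega⟩)⟩
        · exact ⟨1, Or.inl (by rw [Site.eq_iff_two]; exact ⟨by simp [hc], by simp [hc]; omega⟩)⟩
      refine ⟨Walk.cons huc (Walk.cons hcu' β'), fun v hv => ?_⟩
      rw [Walk.support_cons, List.mem_cons, Walk.support_cons, List.mem_cons] at hv
      rcases hv with rfl | rfl | hv
      · exact ⟨⟨v, by simp, Or.inl rfl⟩, v, by simp, rfl⟩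
      · exact ⟨⟨u, by simp, Or.inr huc.symm⟩, u, by simp, by simp [hc]⟩
      · exact lift v hv

end Refine

/-! ### Geometric helpers -/

section Geometry

/-- A lattice neighbour of a site of the box `Λ_H` lies in `Λ_{H+1}`. [folklore] -/
theorem mem_box_succ_of_zdAdj {H : ℕ} {v c : Site 2} (hc : c ∈ box 2 H) (h : (zdGraph 2).Adj v c) :
    v ∈ box 2 (H + 1) := by
  rw [mem_box, Fin.forall_fin_two] at hc
  rw [mem_box, Fin.forall_fin_two]
  push_cast
  rcases (zdGraph_two_adj_iff v c).1 h with ⟨h0, h1⟩ | ⟨h0, h1⟩ | ⟨h1, h0⟩ | ⟨h1, h0⟩ <;> omega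

/-- Every site lies on the ring of its sup-norm. [folklore] -/
theorem onRing_natAbs_max (z : Site 2) : OnRing (max (z 0).natAbs (z 1).natAbs) z := by
  unfold OnRing
  rw [Int.abs_eq_natAbs, Int.abs_eq_natAbs]
  rcases le_total (z 0).natAbs (z 1).natAbs with h | h
  · right; rw [max_eq_right h]; exact ⟨rfl, by exact_mod_cast h⟩
  · left; rw [max_eq_left h]; exact ⟨rfl, by exact_mod_cast h⟩

/-- A site of the ring `{‖x‖_∞ = M}` is outside every smaller box. [folklore] -/
theorem not_mem_box_of_onRing {M H : ℕ} (hHM : H < M) {z : Site 2} (hz : OnRing M z) : z ∉ box 2 H := by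
  rw [mem_box, Fin.forall_fin_two]
  unfold OnRing at hz
  rcases hz with ⟨h0, -⟩ | ⟨h1, -⟩
  · intro h; have := h.1; cases abs_cases (z 0) <;> omega
  · intro h; have := h.2; cases abs_cases (z 1) <;> omega

/-- The axis site `(M, 0)` is on the ring `{‖x‖_∞ = M}`. [folklore] -/
theorem onRing_axis (M : ℕ) : OnRing M (![(M : ℤ), 0] : Site 2) := by
  unfold OnRing; left; simp

end Geometry

/-! ### The `-`site after the last axis site of the `+∗`cluster -/

section Succ

variable {ω : SpinConfig (Site 2)} {x : Site 2}

/-- Lattice neighbours in the upper half-plane of the symmetrised set `F ∪ R(F)`, `F ⊆ π_up`, are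
lattice neighbours of `F`. [folklore] -/
theorem exists_adj_of_adj_union_reflect {F : Set (Site 2)} (hF : F ⊆ halfPlane 0) {v c : Site 2}
    (hv : 0 ≤ v 1) (hc : c ∈ F ∨ Rf c ∈ F) (hadj : (zdGraph 2).Adj v c) : ∃ c' ∈ F, (zdGraph 2).Adj v c' := by
  rcases hc with hc | hc
  · exact ⟨c, hc, hadj⟩
  · have hc1 : 0 ≤ (Rf c) 1 := hF hc
    rw [Rf_apply_one] at hc1
    rcases (zdGraph_two_adj_iff v c).1 hadj with ⟨h0, h1⟩ | ⟨h0, h1⟩ | ⟨h1, h0⟩ | ⟨h1, h0⟩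
    · have hc0 : c 1 = 0 := by omega
      have : Rf c = c := reflectCoord_one_eq_self_of_apply_one hc0
      exact ⟨c, by rwa [this] at hc, hadj⟩
    · have hc0 : c 1 = 0 := by omega
      have : Rf c = c := reflectCoord_one_eq_self_of_apply_one hc0
      exact ⟨c, by rwa [this] at hc, hadj⟩
    · exfalso; omega
    · -- `c = v - e₂` with `v` on the axis: `R c = v + e₂`
      refine ⟨Rf c, hc, ?_⟩
      rw [zdGraph_two_adj_iff]
      simp only [Rf_apply_zero, Rf_apply_one]
      omega

/-- **The `-`cluster starts right after the `+∗`cluster** (contour-free form of Georgii–Higuchi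
2000, Lemma 5.3, "`γ_up` starts between two points of the horizontal axis" with `+`face in
`I^{+∗}_up` and `-`face in `I^-_up`): if `(a, 0)` is the last axis site of an infinite `+∗`cluster of
the upper half-plane, then `(a + 1, 0)` lies in an infinite `-`cluster of the upper half-plane. [cite: GeorgiiHiguchi2000, Lemma 5.3] -/
theorem infinite_minusCluster_succ_of_isMaxAxis
    (hD : (siteCluster zdStarGraph (spinSites 1 ω ∩ halfPlane 0) x).Infinite) {a : ℤ}
    (ha : (![a, 0] : Site 2) ∈ siteCluster zdStarGraph (spinSites 1 ω ∩ halfPlane 0) x)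
    (hmax : ∀ k : ℤ, (![k, 0] : Site 2) ∈ siteCluster zdStarGraph (spinSites 1 ω ∩ halfPlane 0) x → k ≤ a) :
    (siteCluster (zdGraph 2) (spinSites (-1) ω ∩ halfPlane 0) ![a + 1, 0]).Infinite := by
  classical
  set Op := spinSites 1 ω ∩ halfPlane 0 with hOp
  set Om := spinSites (-1) ω ∩ halfPlane 0 with hOm
  set D := siteCluster zdStarGraph Op x with hDdef
  -- `+`sites of the upper half-plane lattice-adjacent to `D` belong to `D`
  have hD_adj : ∀ {z v : Site 2}, z ∈ D → (zdGraph 2).Adj v z → 0 ≤ v 1 → ω v = 1 → v ∈ D :=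
    fun hz hadj hv1 hv => mem_siteCluster_of_adj hz ⟨hv, hv1⟩ (zdGraph_le_zdStarGraph hadj.symm)
  -- `(a+1, 0)` is a `-`site
  have hadj_a : (zdGraph 2).Adj (![a + 1, 0] : Site 2) ![a, 0] := by
    rw [zdGraph_two_adj_iff]; simp
  have hneg : ω ![a + 1, 0] = -1 := by
    rcases Int.units_eq_one_or (ω ![a + 1, 0]) with h | h
    · have := hmax (a + 1) (hD_adj ha hadj_a (by simp) h); omega
    · exact h
  set F := siteCluster (zdGraph 2) Om ![a + 1, 0] with hFdef
  have hF0 : (![a + 1, 0] : Site 2) ∈ F := by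
    rw [hFdef, mem_siteCluster_self_iff]; exact ⟨hneg, by simp [halfPlane]⟩
  have hFsub : F ⊆ halfPlane 0 := fun z hz => hz.2.1.2
  have hFneg : ∀ z ∈ F, ω z = -1 := fun z hz => hz.2.1.1
  -- `-`sites of the upper half-plane lattice-adjacent to `F` belong to `F`
  have hF_adj : ∀ {z v : Site 2}, z ∈ F → (zdGraph 2).Adj v z → 0 ≤ v 1 → ω v = -1 → v ∈ F :=
    fun hz hadj hv1 hv => mem_siteCluster_of_adj hz ⟨hv, hv1⟩ hadj.symm
  by_contra hfin
  rw [Set.not_infinite] at hfin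
  -- the symmetrised finite set `C = F ∪ R(F)`
  set Ff := hfin.toFinset with hFf
  have hmemFf : ∀ z, z ∈ Ff ↔ z ∈ F := fun z => Set.Finite.mem_toFinset hfin
  set C : Finset (Site 2) := Ff ∪ Ff.image Rf with hCdef
  have hmemC : ∀ z, z ∈ C ↔ z ∈ F ∨ Rf z ∈ F := fun z => by
    rw [hCdef, Finset.mem_union, Finset.mem_image, hmemFf]
    constructor
    · rintro (h | ⟨y, hy, rfl⟩)
      · exact Or.inl h
      · right; rw [Rf_Rf]; exact (hmemFf y).1 hy
    · rintro (h | h)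
      · exact Or.inl h
      · exact Or.inr ⟨Rf z, (hmemFf _).2 h, Rf_Rf z⟩
  have hC_symm : ∀ z, Rf z ∈ C ↔ z ∈ C := fun z => by rw [hmemC, hmemC, Rf_Rf]; tauto
  -- lattice neighbours of `C` in the upper half-plane outside `C` are `+`sites adjacent to `F`
  have hbdry : ∀ {v : Site 2}, 0 ≤ v 1 → v ∉ C → (∃ c ∈ C, (zdGraph 2).Adj v c) →
      v ∈ Op ∧ ∃ c' ∈ F, (zdGraph 2).Adj v c' := by
    rintro v hv1 hvC ⟨c, hc, hvc⟩
    obtain ⟨c', hc', hvc'⟩ := exists_adj_of_adj_union_reflect hFsub hv1 ((hmemC c).1 hc) hvc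
    refine ⟨⟨?_, hv1⟩, c', hc', hvc'⟩
    rcases Int.units_eq_one_or (ω v) with h | h
    · exact h
    · exact absurd ((hmemC v).2 (Or.inl (hF_adj hc' hvc' hv1 h))) hvC
  -- a box around `C` and a far site `x₀` of `D`
  obtain ⟨H, hH⟩ := (eventually_subset_box_holds (d := 2) C).exists
  obtain ⟨x₀, hx₀D, hx₀H⟩ := hD.exists_notMem_finset (box 2 (H + 1))
  have hx₀C : x₀ ∉ C := fun h => hx₀H (box_mono 2 (Nat.le_succ H) (hH h))
  have hx₀adj : ∀ c ∈ C, ¬ (zdGraph 2).Adj x₀ c := fun c hc h => hx₀H (mem_box_succ_of_zdAdj (hH hc) h)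
  have hx₀1 : 0 ≤ x₀ 1 := hx₀D.2.1.2
  -- the outer-visible site on the left: through `D`
  obtain ⟨p, hp⟩ := exists_walk_of_mem_siteCluster hx₀D ha
  have hpD : ∀ z ∈ p.support, z ∈ D := fun z hz => mem_siteCluster_of_mem_support hx₀D p hp hz
  obtain ⟨β, hβ⟩ := exists_latticeWalk_of_starWalk_height p
  have haC : (![a + 1, 0] : Site 2) ∈ C := (hmemC _).2 (Or.inl hF0)
  obtain ⟨zL, hzLβ, hzLout, -⟩ := exists_mem_LOutVis_of_walk hx₀C haC (β.concat hadj_a.symm)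
  have hzL_D : zL ∈ D := by
    have hzLC : zL ∉ C := hzLout.1.1
    rw [Walk.support_concat, List.mem_append, List.mem_singleton] at hzLβ
    rcases hzLβ with hzLβ | rfl
    · obtain ⟨⟨z, hz, hzz⟩, z₂, hz₂, hz₂1⟩ := hβ zL hzLβ
      have hzL1 : 0 ≤ zL 1 := by rw [hz₂1]; exact (hpD z₂ hz₂).2.1.2
      rcases hzz with rfl | hadj
      · exact hpD _ hz
      · exact hD_adj (hpD z hz) hadj hzL1 (hbdry hzL1 hzLC hzLout.1.2.1).1.1
    · exact absurd haC hzLC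
  have hzL1 : 0 ≤ zL 1 := hzL_D.2.1.2
  -- the outer-visible site on the right: around the ring through `x₀` and along the axis
  set M : ℕ := max (x₀ 0).natAbs (x₀ 1).natAbs with hM
  have hHM : H + 1 < M := by
    by_contra hle
    push Not at hle
    refine hx₀H ?_
    rw [mem_box, Fin.forall_fin_two]
    have h0 : (x₀ 0).natAbs ≤ H + 1 := (le_max_left _ _).trans hle
    have h1 : (x₀ 1).natAbs ≤ H + 1 := (le_max_right _ _).trans hle
    omega
  obtain ⟨ρ, hρ⟩ := exists_walk_onRing (onRing_natAbs_max x₀) (onRing_axis M)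
  have haM : a + 1 ≤ M := by
    have := hH haC
    rw [mem_box, Fin.forall_fin_two] at this
    simp at this; omega
  set k : ℕ := (↑M - (a + 1)).toNat with hk
  set sL : Site 2 := -Pi.single 0 1 with hsL
  set lineWalk := Zhang.stepRun sL Zhang.adj_add_unitStep.2.1 (![(M : ℤ), 0]) k with hline
  have hend : ((fun w : Site 2 => w + sL)^[k] (![(M : ℤ), 0] : Site 2)) = ![a + 1, 0] := by
    rw [Site.eq_iff_two, Zhang.iterate_add_apply, Zhang.iterate_add_apply]
    simp [hsL]; omega
  obtain ⟨zR, hzRw, hzRout, -⟩ := exists_mem_LOutVis_of_walk hx₀C haC (ρ.append (lineWalk.copy rfl hend))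
  -- `zR = (j, 0)` with `j ≥ a + 2`, a `+`site
  have hzRC : zR ∉ C := hzRout.1.1
  obtain ⟨cR, hcRC, hzRcR⟩ := hzRout.1.2.1
  have hzR_not_ring : ¬ OnRing M zR := fun h =>
    not_mem_box_of_onRing hHM h (mem_box_succ_of_zdAdj (hH hcRC) hzRcR)
  rw [Walk.support_append, List.mem_append] at hzRw
  have hzR_line : zR ∈ lineWalk.support := by
    rcases hzRw with h | h
    · exact absurd (hρ zR h) hzR_not_ring
    · rw [Walk.support_copy] at h; exact List.mem_of_mem_tail h
  obtain ⟨j, hjk, hj0, hj1⟩ := Zhang.mem_support_stepRun.1 hzR_line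
  simp only [hsL] at hj0 hj1
  have hzR1 : zR 1 = 0 := by simpa using hj1
  have hzR_eq : zR = ![zR 0, 0] := eq_axis_of_apply_one hzR1
  have hzR0 : a + 2 ≤ zR 0 := by
    have h1 : a + 1 ≤ zR 0 := by
      have : (j : ℤ) ≤ k := by exact_mod_cast hjk
      simp at hj0; omega
    rcases h1.lt_or_eq with h | h
    · omega
    · exfalso; apply hzRC; rw [hzR_eq, ← h]; exact haC
  have hzR_plus : zR ∈ Op := (hbdry (by rw [hzR1]) hzRC ⟨cR, hcRC, hzRcR⟩).1
  -- `C` is lattice-connected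
  have hFconn : ∀ u ∈ F, ∀ v ∈ F, ∃ q : (zdGraph 2).Walk u v, ∀ z ∈ q.support, z ∈ F := by
    intro u hu v hv
    obtain ⟨q, hq⟩ := exists_walk_of_mem_siteCluster hu hv
    exact ⟨q, fun z hz => mem_siteCluster_of_mem_support hu q hq hz⟩
  have hRconn : ∀ u v : Site 2, Rf u ∈ F → Rf v ∈ F → ∃ q : (zdGraph 2).Walk u v, ∀ z ∈ q.support, Rf z ∈ F := by
    intro u v hu hv
    obtain ⟨q, hq⟩ := hFconn _ hu _ hv
    refine ⟨(q.map (reflectCoord (d := 2) 1).toRelEmbedding.toRelHom).copy (Rf_Rf u) (Rf_Rf v), fun z hz => ?_⟩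
    rw [Walk.support_copy, Walk.support_map, List.mem_map] at hz
    obtain ⟨y, hy, rfl⟩ := hz
    show Rf (Rf y) ∈ F
    rw [Rf_Rf]; exact hq y hy
  have hCconn : ∀ u ∈ C, ∀ v ∈ C, ∃ q : (zdGraph 2).Walk u v, ∀ z ∈ q.support, z ∈ C := by
    have haR : Rf (![a + 1, 0] : Site 2) ∈ F := by
      rw [show Rf (![a + 1, 0] : Site 2) = ![a + 1, 0] from reflectCoord_one_eq_self_of_apply_one (by simp)]
      exact hF0
    have toA : ∀ u ∈ C, ∃ q : (zdGraph 2).Walk u ![a + 1, 0], ∀ z ∈ q.support, z ∈ C := by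
      intro u hu
      rcases (hmemC u).1 hu with hu | hu
      · obtain ⟨q, hq⟩ := hFconn u hu _ hF0
        exact ⟨q, fun z hz => (hmemC z).2 (Or.inl (hq z hz))⟩
      · obtain ⟨q, hq⟩ := hRconn u _ hu haR
        exact ⟨q, fun z hz => (hmemC z).2 (Or.inr (hq z hz))⟩
    intro u hu v hv
    obtain ⟨q₁, hq₁⟩ := toA u hu
    obtain ⟨q₂, hq₂⟩ := toA v hv
    refine ⟨q₁.append q₂.reverse, fun z hz => ?_⟩
    rw [Walk.support_append, List.mem_append, Walk.support_reverse] at hz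
    rcases hz with hz | hz
    · exact hq₁ z hz
    · exact hq₂ z (List.mem_reverse.1 (List.mem_of_mem_tail hz))
  -- Timár: a `∗`-walk in the outer-visible boundary from `zL` to `zR`; fold it into `π_up`
  obtain ⟨q, hq⟩ := exists_starWalk_latticeBoundary hCconn hx₀C hx₀adj hzLout hzRout
  have hfold : ∀ v ∈ q.support, foldSite v ∈ Op := by
    intro v hv
    have hvout := hq v hv
    have hvC : v ∉ C := hvout.1.1
    obtain ⟨c, hc, hvc⟩ := hvout.1.2.1
    rcases foldSite_eq_or v with h | h
    · rw [h]
      have hv1 : 0 ≤ v 1 := by have := foldSite_apply_one v; rw [h] at this; rw [this]; exact abs_nonneg _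
      exact (hbdry hv1 hvC ⟨c, hc, hvc⟩).1
    · rw [h]
      have hv1 : 0 ≤ (Rf v) 1 := by have := foldSite_apply_one v; rw [h] at this; rw [this]; exact abs_nonneg _
      refine (hbdry hv1 (fun h' => hvC ((hC_symm v).1 h')) ⟨Rf c, (hC_symm c).2 hc, ?_⟩).1
      exact ((reflectCoord (d := 2) 1).map_adj_iff).2 hvc
  have hwalk : ∃ q' : zdStarGraph.Walk zL zR, ∀ v ∈ q'.support, v ∈ Op := by
    refine ⟨(q.map starFoldHom).copy (foldSite_of_nonneg hzL1) (foldSite_of_nonneg (by rw [hzR1])), fun v hv => ?_⟩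
    rw [Walk.support_copy, Walk.support_map, List.mem_map] at hv
    obtain ⟨y, hy, rfl⟩ := hv
    exact hfold y hy
  obtain ⟨q', hq'⟩ := hwalk
  have hzR_D : zR ∈ D := mem_siteCluster_of_walk hzL_D q' hq'
  rw [hzR_eq] at hzR_D
  have := hmax _ hzR_D
  omega

end Succ

/-! ### The touching criterion -/

section Touch

variable {ω ω' : SpinConfig (Site 2)} {x x' y : Site 2}

/-- **Touching criterion** (our replacement for "the union of `p_y^-(ω)` and `p_x^+(ω̂)` contains a
`∗`path from `x` to `y`", Georgii–Higuchi 2000, proof of Lemma 5.5, Case 3): let `D` (for `ω`) and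
`D'` (for `ω'`) be infinite `+∗`clusters of the upper half-plane with last axis sites `(a, 0)` resp.
`(a', 0)`, let the infinite `-`clusters of the upper half-plane of `ω` be unique, touch the axis
outside every box and lie to the right of `D`; if `a ≤ a'`, then `D'` and the infinite `-`cluster of
`ω` through `(a + 1, 0)` have two sites which are equal or lattice-adjacent. [cite: GeorgiiHiguchi2000, Lemma 5.5 (proof, Case 3)] -/
theorem touch_of_le_maxAxis
    (hD : (siteCluster zdStarGraph (spinSites 1 ω ∩ halfPlane 0) x).Infinite) {a : ℤ}
    (ha : (![a, 0] : Site 2) ∈ siteCluster zdStarGraph (spinSites 1 ω ∩ halfPlane 0) x)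
    (hmax : ∀ k : ℤ, (![k, 0] : Site 2) ∈ siteCluster zdStarGraph (spinSites 1 ω ∩ halfPlane 0) x → k ≤ a)
    (hside : ∀ (y : Site 2), (siteCluster (zdGraph 2) (spinSites (-1) ω ∩ halfPlane 0) y).Infinite →
      ∀ b k : ℤ, (![b, 0] : Site 2) ∈ siteCluster zdStarGraph (spinSites 1 ω ∩ halfPlane 0) x →
        (![k, 0] : Site 2) ∈ siteCluster (zdGraph 2) (spinSites (-1) ω ∩ halfPlane 0) y → b < k)
    (htouchC : ∀ (y : Site 2), (siteCluster (zdGraph 2) (spinSites (-1) ω ∩ halfPlane 0) y).Infinite →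
      ∀ n : ℕ, ∃ z ∈ siteCluster (zdGraph 2) (spinSites (-1) ω ∩ halfPlane 0) y, z 1 = 0 ∧ (n : ℤ) < |z 0|)
    (hD' : (siteCluster zdStarGraph (spinSites 1 ω' ∩ halfPlane 0) x').Infinite) {a' : ℤ}
    (ha' : (![a', 0] : Site 2) ∈ siteCluster zdStarGraph (spinSites 1 ω' ∩ halfPlane 0) x')
    (haa' : a ≤ a') :
    ∃ z ∈ siteCluster zdStarGraph (spinSites 1 ω' ∩ halfPlane 0) x',
      ∃ z' ∈ siteCluster (zdGraph 2) (spinSites (-1) ω ∩ halfPlane 0) ![a + 1, 0],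
        z = z' ∨ (zdGraph 2).Adj z z' := by
  set C := siteCluster (zdGraph 2) (spinSites (-1) ω ∩ halfPlane 0) ![a + 1, 0] with hCdef
  have hCinf : C.Infinite := infinite_minusCluster_succ_of_isMaxAxis hD ha hmax
  have hC0 : (![a + 1, 0] : Site 2) ∈ C := by
    obtain ⟨y, hy⟩ := hCinf.nonempty
    exact (mem_siteCluster_self_iff _ _ _).2 hy.1
  rcases haa'.lt_or_eq with hlt | heq
  · -- `a < a'`: either `(a', 0) ∈ C`-range interlaces, or `a' = a + 1`
    rcases (show a + 1 ≤ a' by omega).lt_or_eq with hlt' | heq'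
    · -- interlace: `a+1 < a' < k` for a far axis site `k` of `C`; trap lemma
      -- axis sites of `C` are unbounded above (they are `> a`, and far out)
      obtain ⟨zk, hzk, hzk1, hzkn⟩ := htouchC _ hCinf (a'.natAbs + a.natAbs)
      have hk : (![zk 0, 0] : Site 2) ∈ C := by rw [← eq_axis_of_apply_one hzk1]; exact hzk
      have hak : a < zk 0 := hside _ hCinf a (zk 0) ha hk
      have ha'k : a' < zk 0 := by
        push_cast [Int.natCast_natAbs] at hzkn
        cases abs_cases (zk 0) <;> cases abs_cases a <;> cases abs_cases a' <;> omega
      obtain ⟨p, hp⟩ := exists_walk_of_mem_siteCluster hC0 hk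
      have hpC : ∀ z ∈ p.support, z ∈ C := fun z hz => mem_siteCluster_of_mem_support hC0 p hp hz
      by_cases hmem : (![a', 0] : Site 2) ∈ (p.mapLe zdGraph_le_zdStarGraph).support
      · rw [Walk.support_mapLe_eq_support] at hmem
        exact ⟨![a', 0], ha', ![a', 0], hpC _ hmem, Or.inl rfl⟩
      rcases finite_or_touches_of_between hlt' ha'k (p.mapLe zdGraph_le_zdStarGraph)
        (fun z hz => by rw [Walk.support_mapLe_eq_support] at hz; exact (hp z hz).2) hmem
        Set.inter_subset_right ha' with hfin | ⟨w, hwp, z', hz', hwz'⟩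
      · exact absurd hfin hD'
      · rw [Walk.support_mapLe_eq_support] at hwp
        refine ⟨z', hz', w, hpC w hwp, ?_⟩
        rcases hwz' with rfl | h
        · exact Or.inl rfl
        · exact Or.inr h.symm
    · -- `a' = a + 1`: common site
      exact ⟨![a', 0], ha', ![a + 1, 0], hC0, Or.inl (by rw [heq'])⟩
  · -- `a = a'`: `(a', 0) ∈ D'` is lattice-adjacent to `(a + 1, 0) ∈ C`
    refine ⟨![a', 0], ha', ![a + 1, 0], hC0, Or.inr ?_⟩
    rw [zdGraph_two_adj_iff]; simp; omega

end Touch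

end Literature.Probability.LatticeModels
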